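import Literature.Geometry.Lorentzian.OpensCausality
import Literature.Geometry.Lorentzian.CauchyHypersurfaceCausalProofs
import Literature.Geometry.Lorentzian.DevelopmentGluingData
import HarnessLib

/-!
# No timelike entry into a globally hyperbolic subregion from the causal future of its Cauchy
# hypersurface (the causal lemma behind Sbierski 2016, §3.2)

Let `(M, g, τ)` be a time-oriented Lorentzian manifold (Hausdorff, second countable, without
boundary, finite-dimensional model, `C²` metric), `S ⊆ M` an achronal set and `U ⊆ M` an open
subset such that `S ∩ U` is a Cauchy hypersurface of the open sub-spacetime `(U, g|_U, τ|_U)`.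
**Then no future-directed timelike curve starting in `J⁺(S) ∖ U` ever enters `U`**; equivalently
`I⁻(U) ∩ J⁺(S) ⊆ U` (`LorentzianMetric.IsAchronal.mem_opens_of_mem_chronologicalFuture`,
`LorentzianMetric.IsAchronal.chronologicalPast_inter_causalFuture_subset`).

This is the contradiction *"this, however, gives rise to an inextendible timelike curve in `U`
which does not intersect the Cauchy hypersurface `ι(M̄)` — a contradiction to the global
hyperbolicity of `U`"* that J. Sbierski, *On the existence of a maximal Cauchy development for the
Einstein equations: a dezornification*, Ann. Henri Poincaré 17 (2016) 301–329 = arXiv:1309.7591v3,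
§3.2, invokes four times for a common globally hyperbolic development `U ⊆ M` of two developments
`M`, `M'` (footnote to the proof of Lemma 15: achronality of `∂U ∩ J⁺(ι(M̄))`; proof of Lemma 15,
twice: a null geodesic from a point of `∂U` cannot pass through the exterior of `U`; proof of
Lemma 16: the limit point `q < p` cannot lie in the exterior of `U`), on the way to Theorem 12
(a common development with corresponding boundary points is not maximal) — the remaining
unformalised input `h12` of the existence of the maximal globally hyperbolic development in the
tree (`Literature.Geometry.Lorentzian.MCGHDNoCorrespondingBoundary`,
`Literature.Geometry.Lorentzian.MGHDExistenceReduction`). The printed text leaves the construction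
of the offending curve to the reader; here it is: if `r ∈ J⁺(S) ∖ U` and `r ≪ s ∈ U` along the
timelike segment `γ : [a, b] → M`, let `c` be the last parameter with `γ c ∉ U`; the piece
`γ|(c, b]` is a timelike curve of `U` without past endpoint in `U` (a past endpoint would be
`γ c`, by uniqueness of limits), and adjoining the maximal integral curve of a timelike field
through `γ'(b)` extends it to an endless timelike curve of `U` which agrees with `γ` on `(c, b]`
(`LorentzianMetric.exists_isEndlessTimelikeCurve_extends_future` of
`CauchyHypersurfaceCausalProofs`, applied in the sub-spacetime `U`). By the Cauchy property it
meets `S` at some parameter `t₀`; whether `t₀ ∈ (c, b]` or `t₀ > b`, push-up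
(`mem_chronologicalFuture_of_mem_causalFuture`, O'Neill's Cor. 14.1) turns `z ≤ r ≪ γ t₀`
(`z ∈ S`) into `z ≪ γ t₀`, two chronologically related points of the achronal set `S`.

* `LorentzianMetric.IsAchronal.mem_opens_of_mem_chronologicalFuture` — the displayed statement;
  `LorentzianMetric.IsAchronal.chronologicalPast_inter_causalFuture_subset` — its set form
  `I⁻(U) ∩ J⁺(S) ⊆ U`; `LorentzianMetric.IsAchronal.mem_opens_of_mem_closure_of_mem_chronologicalFuture`
  — the same with `s` only in the closure of `U` (`I⁺(r)` is open);
* `LorentzianMetric.IsAchronal.mem_opens_of_mem_causalFuture`,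
  `LorentzianMetric.IsAchronal.causalPast_inter_causalFuture_subset` — **no causal entry either**,
  `J⁻(U) ∩ J⁺(S) ⊆ U` (push-up after a short timelike step inside the open set `U`);
* `LorentzianMetric.IsAchronal.isAchronal_frontier_inter_causalFuture` — **`∂U ∩ J⁺(S)` is
  achronal** (the footnote to the proof of Sbierski's Lemma 15);
* `CauchyDevelopment.CommonDevelopment.mem_opens_of_mem_chronologicalFuture`,
  `CauchyDevelopment.CommonDevelopment.isAchronal_frontier_inter_causalFuture` — the instances for
  a common globally hyperbolic development `(U, ψ)` of two Cauchy developments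
  (`DevelopmentGluingData`), `S = ι(X)` (achronal as a Cauchy hypersurface of `M`, O'Neill's
  Lemma 14.29, `IsCauchyHypersurface.isAchronal_holds`).

Everything is proved; no definitions, no named facts (D-0026). The time-dual statement (no
timelike exit from `U` into `J⁻(S) ∖ U`) is not recorded here.

## References

* J. Sbierski, Ann. Henri Poincaré 17 (2016) 301–329 = arXiv:1309.7591v3, §3.2, Lemma 15 (with
  its footnote) and Lemma 16 (arXiv numbering). [Sbierski2016AHP]
* B. O'Neill, *Semi-Riemannian geometry with applications to relativity*, Academic Press 1983,
  Ch. 14, Cor. 14.1 (push-up, p. 402), Def. 14.28 and Lemma 14.29 (Cauchy hypersurfaces are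
  achronal, p. 415), Prop. 14.31 (maximal integral curves are inextendible, p. 417).
  [ONeillSemiRiemannian1983]
* H. Ringström, *The Cauchy Problem in General Relativity*, EMS 2009, Ch. 23. [Ringstrom2009]
-/

noncomputable section

open Set Filter Function TopologicalSpace
open scoped Manifold ContDiff Topology

namespace Literature.Geometry.Lorentzian

universe u

variable {E : Type*} [NormedAddCommGroup E] [NormedSpace ℝ E] {H : Type*} [TopologicalSpace H]
  {I : ModelWithCorners ℝ E H} {n : ℕ∞ω} {M : Type*} [TopologicalSpace M] [ChartedSpace H M]
  [IsManifold I ∞ M]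

namespace LorentzianMetric

variable {g : LorentzianMetric I n M} {τ : TimeOrientation g}

/-! ### No timelike entry from `J⁺(S) ∖ U` -/

/-- **No timelike curve enters a globally hyperbolic subregion from the causal future of its
Cauchy hypersurface.** Let `S ⊆ M` be achronal and `U ⊆ M` open with `S ∩ U` a Cauchy
hypersurface of the open sub-spacetime `(U, g|_U, τ|_U)`. If `r ∈ J⁺(S)`, `s ∈ U` and `r ≪ s`,
then `r ∈ U`. Otherwise, along a timelike segment `γ` from `r` to `s`, the piece of `γ` after its
last parameter `c` outside `U` is a past-endless timelike curve of `U` (a past endpoint in `U`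
would equal `γ c ∉ U`); extended to the future inside `U`
(`exists_isEndlessTimelikeCurve_extends_future`) it is an endless timelike curve of `U`, so it
meets `S` at a point `x`, and push-up (`z ≤ r ≪ x` for some `z ∈ S`) gives `z ≪ x` with
`z, x ∈ S`, contradicting achronality. This is the step *"gives rise to an inextendible timelike
curve in `U` which does not intersect the Cauchy hypersurface — a contradiction to the global
hyperbolicity of `U`"* of Sbierski 2016, §3.2 (footnote to Lemma 15; proofs of Lemmas 15, 16).
[cite: Sbierski2016AHP, §3.2, Lemma 15 (footnote and proof) and Lemma 16 (arXiv numbering)] -/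
theorem IsAchronal.mem_opens_of_mem_chronologicalFuture [T2Space M] [SecondCountableTopology M]
    [BoundarylessManifold I M] [FiniteDimensional ℝ E] (hn : 2 ≤ n)
    (hres : PseudoRiemannianMetric.contMDiff_restrict (I := I) (n := n) (M := M))
    (hτ : τ.contMDiff_restrict) {S : Set M} (hS : g.IsAchronal τ S) {U : Opens M}
    (hU : (g.restrict hres U).IsCauchyHypersurface (τ.restrict hres hτ U) (Subtype.val ⁻¹' S))
    {r s : M} (hr : r ∈ g.causalFuture τ S) (hsU : s ∈ U)
    (hrs : s ∈ g.chronologicalFuture τ {r}) : r ∈ U := by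
  classical
  by_contra hrU
  have hn1 : (1 : ℕ∞ω) ≤ n := le_trans one_le_two hn
  -- a point `z ∈ S` with `z ≤ r`
  obtain ⟨z, hzS, hrz⟩ : ∃ z ∈ S, r ∈ g.causalFuture τ {z} := by
    have h := hr
    rw [causalFuture_eq_biUnion] at h
    simpa only [mem_iUnion, exists_prop] using h
  -- the timelike segment from `r` to `s`
  obtain ⟨r', hr', γ, a, b, hab, hγ, hγa, hγb⟩ := hrs
  have hr'' : r' = r := hr'
  subst hr'' hγa hγb
  have hcont : ∀ t ∈ Icc a b, ContinuousAt γ t := fun t ht ↦ (hγ t ht).1.continuousAt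
  -- the last parameter `c` with `γ c ∉ U`
  set A : Set ℝ := Icc a b ∩ γ ⁻¹' ((U : Set M)ᶜ) with hA_def
  have hAcl : IsClosed A :=
    (continuousOn_of_forall_continuousAt hcont).preimage_isClosed_of_isClosed isClosed_Icc
      U.2.isClosed_compl
  have haA : a ∈ A := ⟨left_mem_Icc.mpr hab.le, (fun h ↦ hrU h : γ a ∉ (U : Set M))⟩
  have hAbdd : BddAbove A := ⟨b, fun t ht ↦ ht.1.2⟩
  set c := sSup A with hc_def
  have hcA : c ∈ A := hAcl.csSup_mem ⟨a, haA⟩ hAbdd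
  have hac : a ≤ c := hcA.1.1
  have hγc : γ c ∉ U := hcA.2
  have hcb : c < b := lt_of_le_of_ne hcA.1.2 fun h ↦ hγc (by rw [h]; exact hsU)
  have hin : ∀ t ∈ Ioc c b, γ t ∈ U := fun t ht ↦ by
    by_contra h
    exact (not_le.mpr ht.1) (le_csSup hAbdd ⟨⟨hac.trans ht.1.le, ht.2⟩, h⟩)
  -- the piece `γ|(c, b]` as a curve of `U`
  set δ : ℝ → U := fun t ↦ if h : γ t ∈ U then ⟨γ t, h⟩ else ⟨γ b, hsU⟩ with hδ_def
  have hδval : ∀ t ∈ Ioc c b, (δ t : M) = γ t := fun t ht ↦ by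
    simp only [hδ_def, dif_pos (hin t ht)]
  have hδev : ∀ t ∈ Ioc c b, (Subtype.val ∘ δ) =ᶠ[𝓝 t] γ := fun t ht ↦ by
    have hmem : γ ⁻¹' (U : Set M) ∈ 𝓝 t :=
      (hcont t ⟨hac.trans ht.1.le, ht.2⟩).preimage_mem_nhds (U.2.mem_nhds (hin t ht))
    filter_upwards [hmem] with t' ht'
    simp only [comp_apply, hδ_def, dif_pos (show γ t' ∈ U from ht')]
  have hδt : (g.restrict hres U).IsFutureTimelikeCurveOn (τ.restrict hres hτ U) δ (Ioc c b) := by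
    rw [isFutureTimelikeCurveOn_restrict_iff]
    intro t ht
    obtain ⟨hd, h1, h2⟩ := hγ t ⟨hac.trans ht.1.le, ht.2⟩
    have hveq : velocity I (Subtype.val ∘ δ) t = velocity I γ t :=
      DFunLike.congr_fun (hδev t ht).mfderiv_eq (1 : ℝ)
    refine ⟨(hδev t ht).mdifferentiableAt_iff.2 hd, ?_, ?_⟩
    · change g.val (δ t : M) (velocity I (Subtype.val ∘ δ) t) (velocity I (Subtype.val ∘ δ) t) < 0
      rw [hveq, hδval t ht]
      exact h1
    · change (g.val (δ t : M) (velocity I (Subtype.val ∘ δ) t)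
          (velocity I (Subtype.val ∘ δ) t) ≤ 0 ∧ velocity I (Subtype.val ∘ δ) t ≠ 0) ∧
        g.val (δ t : M) (τ.vectorField (δ t : M)) (velocity I (Subtype.val ∘ δ) t) < 0
      rw [hveq, hδval t ht]
      exact h2
  -- `γ|(c, b]` has no past endpoint in `U`: it would be `γ c ∉ U`
  have hδp : IsPastEndless δ (Ioc c b) := by
    refine ⟨⟨b, right_mem_Ioc.mpr hcb⟩, fun q hq ↦ hγc ?_⟩
    have h1 : HasPastEndpoint (Subtype.val ∘ δ) (Ioc c b) (q : M) :=
      hasPastEndpoint_subtypeVal_comp_iff.2 hq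
    have h2 : HasPastEndpoint γ (Ioc c b) (q : M) := by
      have heq : (fun t : Ioc c b ↦ (Subtype.val ∘ δ) t) = fun t : Ioc c b ↦ γ t :=
        funext fun t ↦ hδval t t.2
      rw [HasPastEndpoint] at h1 ⊢
      rwa [heq] at h1
    have h3 : HasPastEndpoint γ (Ioi c) (q : M) :=
      (hasPastEndpoint_congr_set (right_mem_Ioc.mpr hcb : b ∈ Ioc c b) (mem_Ioi.mpr hcb)
        (fun t htb ↦ ⟨fun h ↦ h.1, fun h ↦ ⟨h, htb⟩⟩) _).1 h2
    rw [hasPastEndpoint_Ioi_iff] at h3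
    have h4 : Tendsto γ (𝓝[>] c) (𝓝 (γ c)) := ((hcont c hcA.1).continuousWithinAt).tendsto
    have h5 : (q : M) = γ c := tendsto_nhds_unique h3 h4
    rw [← h5]
    exact q.2
  -- extend inside `U` to an endless timelike curve of `U` through `γ|(c, b]`
  -- (`exists_isEndlessTimelikeCurve_extends_future`, `CauchyHypersurfaceCausalProofs`)
  obtain ⟨Δ, D, hΔ, hsD, hΔeq, hDnew⟩ :=
    exists_isEndlessTimelikeCurve_extends_future (g := g.restrict hres U)
      (τ := τ.restrict hres hτ U) hn ordConnected_Ioc (right_mem_Ioc.mpr hcb)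
      (fun t ht ↦ ht.2) hδt hδp
  -- it meets `S`
  obtain ⟨t₀, ⟨ht₀D, ht₀S⟩, -⟩ := hU Δ D hΔ
  by_cases ht₀ : t₀ ∈ Ioc c b
  · -- crossing on the original piece: `z ≤ γ a ≪ γ t₀ ∈ S`
    have hx : (Δ t₀ : M) = γ t₀ := by rw [hΔeq t₀ ht₀, hδval t₀ ht₀]
    have hat₀ : a < t₀ := hac.trans_lt ht₀.1
    have hI : γ t₀ ∈ g.chronologicalFuture τ {γ a} :=
      ⟨γ a, rfl, γ, a, t₀, hat₀, hγ.mono (Icc_subset_Icc_right ht₀.2), rfl, rfl⟩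
    have hzx : γ t₀ ∈ g.chronologicalFuture τ {z} :=
      mem_chronologicalFuture_of_mem_causalFuture hn1 hrz hI
    exact hS z hzS (γ t₀) (hx ▸ ht₀S) hzx
  · -- crossing on the extension: `z ≤ γ a ≪ γ b ≪ Δ t₀ ∈ S`
    -- the new point lies in `I⁺(γ b)` of the sub-spacetime `U`, hence of `M`
    obtain ⟨p, hp, β, a', b', hab', hβ, hβa, hβb⟩ := hDnew t₀ ht₀D ht₀
    rw [mem_singleton_iff] at hp
    have hβM : g.IsFutureTimelikeCurveOn τ (Subtype.val ∘ β) (Icc a' b') :=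
      (isFutureTimelikeCurveOn_restrict_iff g τ hres hτ U).1 hβ
    have hI₂ : (Δ t₀ : M) ∈ g.chronologicalFuture τ {γ b} := by
      refine ⟨γ b, rfl, Subtype.val ∘ β, a', b', hab', hβM, ?_, ?_⟩
      · rw [comp_apply, hβa, hp, hδval b (right_mem_Ioc.mpr hcb)]
      · rw [comp_apply, hβb]
    have hI₁ : γ b ∈ g.chronologicalFuture τ {γ a} := ⟨γ a, rfl, γ, a, b, hab, hγ, rfl, rfl⟩
    have hzb : γ b ∈ g.chronologicalFuture τ {z} :=
      mem_chronologicalFuture_of_mem_causalFuture hn1 hrz hI₁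
    exact hS z hzS _ ht₀S (mem_chronologicalFuture_trans hzb hI₂)

/-- **Set form: `I⁻(U) ∩ J⁺(S) ⊆ U`** — within the causal future of the achronal set `S`, an open
subregion `U` in which `S ∩ U` is a Cauchy hypersurface is a past set. Sbierski 2016, §3.2
(the contradiction used in Lemmas 15–16). [cite: Sbierski2016AHP, §3.2, Lemmas 15–16 (arXiv numbering)] -/
theorem IsAchronal.chronologicalPast_inter_causalFuture_subset [T2Space M]
    [SecondCountableTopology M] [BoundarylessManifold I M] [FiniteDimensional ℝ E] (hn : 2 ≤ n)
    (hres : PseudoRiemannianMetric.contMDiff_restrict (I := I) (n := n) (M := M))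
    (hτ : τ.contMDiff_restrict) {S : Set M} (hS : g.IsAchronal τ S) {U : Opens M}
    (hU : (g.restrict hres U).IsCauchyHypersurface (τ.restrict hres hτ U) (Subtype.val ⁻¹' S)) :
    g.chronologicalPast τ (U : Set M) ∩ g.causalFuture τ S ⊆ (U : Set M) := by
  rintro r ⟨hrU, hrS⟩
  rw [chronologicalPast, chronologicalFuture_eq_biUnion] at hrU
  simp only [mem_iUnion, exists_prop] at hrU
  obtain ⟨s, hsU, hrs⟩ := hrU
  exact hS.mem_opens_of_mem_chronologicalFuture hn hres hτ hU hrS hsU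
    (mem_chronologicalFuture_of_mem_chronologicalPast hrs)

/-- **No timelike entry, closure form.** Under the same hypotheses, if `r ∈ J⁺(S)` and some point
`y` of the CLOSURE of `U` satisfies `r ≪ y`, then `r ∈ U`: `I⁺(r)` is an open neighbourhood of `y`
(O'Neill's Lemma 14.3), hence contains a point `s ∈ U`, and `mem_opens_of_mem_chronologicalFuture`
applies. This is the form used in the footnote to Lemma 15 of Sbierski 2016, §3.2 ("we could also
find … `y' ∈ U ∩ J⁺(ι(M̄))` close to `y` such that `x' ≪ y'`").
[cite: Sbierski2016AHP, §3.2, footnote to the proof of Lemma 15 (arXiv numbering)] -/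
theorem IsAchronal.mem_opens_of_mem_closure_of_mem_chronologicalFuture [T2Space M]
    [SecondCountableTopology M] [BoundarylessManifold I M] [FiniteDimensional ℝ E] (hn : 2 ≤ n)
    (hres : PseudoRiemannianMetric.contMDiff_restrict (I := I) (n := n) (M := M))
    (hτ : τ.contMDiff_restrict) {S : Set M} (hS : g.IsAchronal τ S) {U : Opens M}
    (hU : (g.restrict hres U).IsCauchyHypersurface (τ.restrict hres hτ U) (Subtype.val ⁻¹' S))
    {r y : M} (hr : r ∈ g.causalFuture τ S) (hy : y ∈ closure (U : Set M))
    (hry : y ∈ g.chronologicalFuture τ {r}) : r ∈ U := by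
  obtain ⟨s, hsI, hsU⟩ : (g.chronologicalFuture τ {r} ∩ (U : Set M)).Nonempty :=
    mem_closure_iff.1 hy _ (isOpen_chronologicalFuture_of_boundaryless g τ {r}) hry
  exact hS.mem_opens_of_mem_chronologicalFuture hn hres hτ hU hr hsU hsI

/-- **No causal entry either**: under the same hypotheses, if `r ∈ J⁺(S)`, `s ∈ U` and `r ≤ s`
(`s ∈ J⁺(r)`), then `r ∈ U`. Since `U` is open and `s ∈ closure I⁺(s)`
(`subset_closure_chronologicalFuture`), some `s' ∈ U` has `s ≪ s'`; push-up (O'Neill's Cor. 14.1,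
`mem_chronologicalFuture_of_mem_causalFuture`) gives `r ≪ s'`, and
`mem_opens_of_mem_chronologicalFuture` applies. This is the step *"if there were a `0 < t < 1`
with `γ(t) ∈ U` then global hyperbolicity of `U` would imply that `γ(1) = q ∈ U` as well"* in the
proof of Lemma 15 of Sbierski 2016, §3.2. [cite: Sbierski2016AHP, §3.2, proof of Lemma 15 (arXiv numbering)] -/
theorem IsAchronal.mem_opens_of_mem_causalFuture [T2Space M] [SecondCountableTopology M]
    [BoundarylessManifold I M] [FiniteDimensional ℝ E] (hn : 2 ≤ n)
    (hres : PseudoRiemannianMetric.contMDiff_restrict (I := I) (n := n) (M := M))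
    (hτ : τ.contMDiff_restrict) {S : Set M} (hS : g.IsAchronal τ S) {U : Opens M}
    (hU : (g.restrict hres U).IsCauchyHypersurface (τ.restrict hres hτ U) (Subtype.val ⁻¹' S))
    {r s : M} (hr : r ∈ g.causalFuture τ S) (hsU : s ∈ U) (hrs : s ∈ g.causalFuture τ {r}) :
    r ∈ U := by
  have hn1 : (1 : ℕ∞ω) ≤ n := le_trans one_le_two hn
  obtain ⟨s', hs'U, hs'I⟩ : ((U : Set M) ∩ g.chronologicalFuture τ {s}).Nonempty :=
    mem_closure_iff.1 (subset_closure_chronologicalFuture (g := g) (τ := τ) {s} rfl) _ U.2 hsU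
  exact hS.mem_opens_of_mem_chronologicalFuture hn hres hτ hU hr hs'U
    (mem_chronologicalFuture_of_mem_causalFuture hn1 hrs hs'I)

/-- **Set form: `J⁻(U) ∩ J⁺(S) ⊆ U`** — within `J⁺(S)` the subregion `U` is causally
past-closed. Sbierski 2016, §3.2 (proof of Lemma 15). [cite: Sbierski2016AHP, §3.2, proof of Lemma 15 (arXiv numbering)] -/
theorem IsAchronal.causalPast_inter_causalFuture_subset [T2Space M] [SecondCountableTopology M]
    [BoundarylessManifold I M] [FiniteDimensional ℝ E] (hn : 2 ≤ n)
    (hres : PseudoRiemannianMetric.contMDiff_restrict (I := I) (n := n) (M := M))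
    (hτ : τ.contMDiff_restrict) {S : Set M} (hS : g.IsAchronal τ S) {U : Opens M}
    (hU : (g.restrict hres U).IsCauchyHypersurface (τ.restrict hres hτ U) (Subtype.val ⁻¹' S)) :
    g.causalPast τ (U : Set M) ∩ g.causalFuture τ S ⊆ (U : Set M) := by
  rintro r ⟨hrU, hrS⟩
  rw [causalPast, causalFuture_eq_biUnion] at hrU
  simp only [mem_iUnion, exists_prop] at hrU
  obtain ⟨s, hsU, hrs⟩ := hrU
  exact hS.mem_opens_of_mem_causalFuture hn hres hτ hU hrS hsU (mem_causalPast_singleton_iff.1 hrs)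

/-- **The future boundary of a globally hyperbolic subregion is achronal**: under the same
hypotheses, `∂U ∩ J⁺(S)` is an achronal set — the footnote to the proof of Lemma 15 of Sbierski
2016, §3.2: *"That `∂U ∩ J⁺(ι(M̄))` is achronal follows from `≪` being an open relation … This,
however, gives rise to an inextendible timelike curve in `U` which does not intersect the Cauchy
hypersurface `ι(M̄)` — a contradiction to the global hyperbolicity of `U`."* Indeed if `x ≪ y`
with `x, y ∈ ∂U ∩ J⁺(S)`, then `y ∈ closure U` forces `x ∈ U`
(`mem_opens_of_mem_closure_of_mem_chronologicalFuture`), while `x ∈ ∂U` and `U` is open.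
[cite: Sbierski2016AHP, §3.2, footnote to the proof of Lemma 15 (arXiv numbering)] -/
theorem IsAchronal.isAchronal_frontier_inter_causalFuture [T2Space M]
    [SecondCountableTopology M] [BoundarylessManifold I M] [FiniteDimensional ℝ E] (hn : 2 ≤ n)
    (hres : PseudoRiemannianMetric.contMDiff_restrict (I := I) (n := n) (M := M))
    (hτ : τ.contMDiff_restrict) {S : Set M} (hS : g.IsAchronal τ S) {U : Opens M}
    (hU : (g.restrict hres U).IsCauchyHypersurface (τ.restrict hres hτ U) (Subtype.val ⁻¹' S)) :
    g.IsAchronal τ (frontier (U : Set M) ∩ g.causalFuture τ S) := by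
  intro x hx y hy hxy
  have hxU : x ∈ U :=
    hS.mem_opens_of_mem_closure_of_mem_chronologicalFuture hn hres hτ hU hx.2
      (frontier_subset_closure hy.1) hxy
  have hdis := U.2.inter_frontier_eq
  exact (eq_empty_iff_forall_notMem.1 hdis) x ⟨hxU, hx.1⟩

end LorentzianMetric

/-! ### The instance for common globally hyperbolic developments -/

namespace CauchyDevelopment.CommonDevelopment

variable {k : ℕ} {X : Type u} [TopologicalSpace X] [ChartedSpace (EuclideanSpace ℝ (Fin k)) X]
  [IsManifold (𝓡 k) ∞ X] [ConnectedSpace X] {D : InitialDataSet (𝓡 k) X}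
  {𝒟 𝒟' : CauchyDevelopment D}

/-- **A common globally hyperbolic development admits no timelike entry from `J⁺(ι(X)) ∖ U`.**
For a common development `(U, ψ)` of the Cauchy developments `𝒟`, `𝒟'` (Sbierski 2016, Def. 2.4,
`DevelopmentGluingData`): if `r ∈ J⁺(ι(X))`, `s ∈ U` and `r ≪ s` in `M`, then `r ∈ U` — the
data hypersurface `ι(X)` is achronal in `M` (a Cauchy hypersurface, O'Neill's Lemma 14.29) and a
Cauchy hypersurface of `(U, g|_U, τ|_U)`. Sbierski 2016, §3.2 (Lemmas 15–16).
[cite: Sbierski2016AHP, §3.2, Lemmas 15–16 (arXiv numbering)] -/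
theorem mem_opens_of_mem_chronologicalFuture (𝔠 : CommonDevelopment 𝒟 𝒟') {r s : 𝒟.carrier}
    (hr : r ∈ 𝒟.metric.causalFuture 𝒟.timeOrientation (range 𝒟.embed)) (hs : s ∈ 𝔠.opens)
    (hrs : s ∈ 𝒟.metric.chronologicalFuture 𝒟.timeOrientation {r}) : r ∈ 𝔠.opens := by
  have hn2 : (2 : ℕ∞ω) ≤ ∞ := WithTop.coe_le_coe.mpr le_top
  have hA : 𝒟.metric.IsAchronal 𝒟.timeOrientation (range 𝒟.embed) :=
    LorentzianMetric.IsCauchyHypersurface.isAchronal_holds hn2 𝒟.isCauchyHypersurface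
  exact hA.mem_opens_of_mem_chronologicalFuture hn2 _ _ 𝔠.isCauchyHypersurface hr hs hrs

/-- **The future boundary `∂U ∩ J⁺(ι(X))` of a common globally hyperbolic development is
achronal** (footnote to the proof of Lemma 15 of Sbierski 2016, §3.2).
[cite: Sbierski2016AHP, §3.2, footnote to the proof of Lemma 15 (arXiv numbering)] -/
theorem isAchronal_frontier_inter_causalFuture (𝔠 : CommonDevelopment 𝒟 𝒟') :
    𝒟.metric.IsAchronal 𝒟.timeOrientation
      (frontier (𝔠.opens : Set 𝒟.carrier) ∩
        𝒟.metric.causalFuture 𝒟.timeOrientation (range 𝒟.embed)) := by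
  have hn2 : (2 : ℕ∞ω) ≤ ∞ := WithTop.coe_le_coe.mpr le_top
  have hA : 𝒟.metric.IsAchronal 𝒟.timeOrientation (range 𝒟.embed) :=
    LorentzianMetric.IsCauchyHypersurface.isAchronal_holds hn2 𝒟.isCauchyHypersurface
  exact hA.isAchronal_frontier_inter_causalFuture hn2 _ _ 𝔠.isCauchyHypersurface

end CauchyDevelopment.CommonDevelopment

end Literature.Geometry.Lorentzian

end
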